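import Literature.Analysis.Distribution.EllipticReproducingKernel
import Literature.NumberTheory.Automorphic.ArchimedeanExpChart
import Literature.NumberTheory.Automorphic.ArchimedeanEnvelopingActionRegular
import Literature.NumberTheory.Automorphic.AutomorphicFormsSpan
import Literature.NumberTheory.Automorphic.AutomorphicFormsProofs
import HarnessLib

/-!
# Moderate growth of Lie derivatives of automorphic forms from an elliptic annihilator
# and elliptic regularity (Folland 1995, (6.34) and (8.45)); Borel–Jacquet 4.3 reduced to them

Topic `NumberTheory/Automorphic`; sibling proof file of `AutomorphicForms` on the named fact
`automorphicForms_isStableSubmodule 𝒟` (Borel–Jacquet 1979, 4.3: the space of automorphic forms of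
a regular automorphy datum is `(𝔤, K_∞) × G(𝔸_f)`-stable). The tree reduces the fact to the
moderate growth of the Lie derivatives `X φ` of automorphic forms
(`automorphicForms_isStableSubmodule_of_hasModerateGrowth_lieDeriv`, `ArchimedeanEnvelopingActionRegular`),
in print Harish-Chandra's convolution identity `φ = φ ∗ α` (Harish-Chandra 1966, §8, Thm. 1;
Borel 1972, 3.18). This file PROVES that moderate growth by the route "elliptic annihilator +
fundamental solution", on the two named facts of elliptic regularity of
`Literature.Analysis.Distribution.EllipticRegularity` (Folland 1995, Cor. (6.34): elliptic
operators are hypoelliptic; Thm. (8.45): elliptic equations are locally solvable):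

* §1 `iterate_sqSum_eq_sum_pairWord` — the powers of a sum of squares `L_B = ∑ᵢ Bᵢ Bᵢ` of Lie
  derivatives are sums of word operators, `L_B^j φ = ∑_{f : Fin j → Fin d} B_{f₀} B_{f₀} ⋯ φ`
  (smooth `φ`); `annihilator_words` — an identity `∑ⱼ rⱼ L_B^j φ = 0` is a constant-coefficient
  word identity `∑_{w ∈ S} c_w B_w φ = 0` over the doubled words `pairWord`;
* §2 `principalSymbol_pairPresentation`, `isEllipticOn_pairPresentation` — in smooth vector
  fields `Ξᵢ` on `ℝ^d` the same words present `∑ⱼ rⱼ (∑ᵢ Ξᵢ²)^j` as a `smoothDiffOp` whose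
  principal symbol of order `2M` (`r_M = 1`) is `(∑ᵢ ξ(Ξᵢ(x))²)^M`, elliptic wherever the `Ξᵢ(x)`
  span (`det (Ξᵢ(x)ⱼ) ≠ 0`, an open condition holding at `0` for the chart fields);
* §3 `HasModerateGrowth.lieDeriv_basisLie_of_folland` — **if an automorphic form `φ` satisfies
  `∑ⱼ rⱼ L_B^j φ = 0` (`r_M = 1`) for a basis `B` of `𝔤`, then every `Bᵢ φ` has moderate growth**:
  by `ArchimedeanExpChart` the chart functions `t ↦ φ (g ι(exp ∑ tᵢBᵢ))` of ALL translates solve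
  the transported equation near `0`, which is elliptic of order `2M`; the reproducing kernel
  `α ∈ C_c^∞` of `EllipticReproducingKernel` (from (8.45) and (6.34)) gives
  `φ (g') = ∫ α(t) φ (g' ι(chartExp t)) dt` for every `g'`, whence
  `|(Bᵢ φ)(g)| ≤ Cᵢ sup_{t ∈ supp α} |φ (g ι(chartExp t))| ≤ Cᵢ C₀ Dʳ (1 ⊔ ‖g‖)ʳ`
  (`exists_norm_lieDeriv_le_of_reproducing`; height axiom on the compact set `chartExp (supp α)`);
  `HasModerateGrowth.lieDeriv_of_folland` — hence every `X φ`, `X ∈ 𝔤`;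
* §4 `automorphicForms_isStableSubmodule_of_folland_of_annihilators` — **Borel–Jacquet 4.3 holds
  for every regular datum whose automorphic forms admit such annihilators, granted (6.34) and
  (8.45)**. The annihilator itself (a real monic polynomial in the Casimir-plus-`𝔨` sum of
  squares, Borel 1972, 3.15–3.16) is supplied by `AutomorphicFormsEllipticAnnihilator`.

Everything here is proved; the only definitions are the doubled words `pairWord`, their finset
`pairWords`, the coefficients `pairCoeff` and the field matrix `fieldMatrix`; no named facts (the
two Folland facts enter as hypotheses `h634`, `h845`).

## References

* G. B. Folland, *Introduction to Partial Differential Equations*, 2nd ed. (1995), Cor. (6.34),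
  Thm. (8.45) [Folland2020].
* Harish-Chandra, *Discrete series for semisimple Lie groups. II*, Acta Math. 116 (1966), §8
  [HarishChandra1966].
* A. Borel, *Représentations de groupes localement compacts*, LNM 276 (1972), 3.15–3.18 [Borel1972].
* A. Borel, H. Jacquet, *Automorphic forms and automorphic representations*, Proc. Sympos. Pure
  Math. 33 (1979), Part 1, 4.3 [BorelJacquetCorvallis1979].
-/

noncomputable section

open scoped MatrixGroups Matrix ContDiff Topology
open Filter Set MeasureTheory Literature.Analysis.Distribution

namespace Literature.NumberTheory.Automorphic

-- Mathlib idiom (Mathlib/Algebra/Lie/OfAssociative.lean); needed to mention Lie subalgebras of matrix algebras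
attribute [local instance 100] LieRing.ofAssociativeRing

/-! ### §1 Doubled words and the expansion of `L_B^j` -/

section Words

variable {d : ℕ}

/-- The doubled word of `f : Fin j → Fin d`: `[f 0, f 0, f 1, f 1, …, f (j-1), f (j-1)]`.
[folklore] -/
def pairWord {j : ℕ} (f : Fin j → Fin d) : List (Fin d) :=
  (List.ofFn f).flatMap fun i => [i, i]

/-- `pairWord` of the empty function is the empty word. [folklore] -/
@[simp] theorem pairWord_zero (f : Fin 0 → Fin d) : pairWord f = [] := by
  simp [pairWord]

/-- `pairWord (i, f) = i :: i :: pairWord f`. [folklore] -/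
theorem pairWord_cons {j : ℕ} (i : Fin d) (f : Fin j → Fin d) :
    pairWord (Fin.cons i f : Fin (j + 1) → Fin d) = i :: i :: pairWord f := by
  simp [pairWord, List.ofFn_succ]

/-- The doubled word of `f : Fin j → Fin d` has length `2j`. [folklore] -/
theorem length_pairWord {j : ℕ} (f : Fin j → Fin d) : (pairWord f).length = 2 * j := by
  induction j with
  | zero => simp
  | succ j ih =>
    rw [← Fin.cons_self_tail f, pairWord_cons, List.length_cons, List.length_cons, ih]
    ring

/-- The product over a doubled word: `∏ (pairWord f).map a = ∏ₖ a (f k) * a (f k)`. [folklore] -/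
theorem prod_map_pairWord {R : Type*} [CommMonoid R] {j : ℕ} (f : Fin j → Fin d) (a : Fin d → R) :
    ((pairWord f).map a).prod = ∏ k, (a (f k) * a (f k)) := by
  induction j with
  | zero => simp
  | succ j ih =>
    rw [← Fin.cons_self_tail f, pairWord_cons, List.map_cons, List.map_cons, List.prod_cons,
      List.prod_cons, ih, Fin.prod_univ_succ]
    simp only [Fin.cons_zero, Fin.cons_succ]
    rw [mul_assoc]

/-- The index type of the expansion of `∑ⱼ rⱼ L^j`: pairs `(j, f)` with `f : Fin j → Fin d`.
[folklore] -/
abbrev PairIndex (d : ℕ) : Type := Σ j : ℕ, (Fin j → Fin d)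

/-- The finite set of pairs `(j, f)` with `j ≤ M`. [folklore] -/
def pairIndices (d M : ℕ) : Finset (PairIndex d) :=
  (Finset.range (M + 1)).sigma fun _ => Finset.univ

/-- The finset of doubled words of the pairs `(j, f)`, `j ≤ M`. [folklore] -/
def pairWords (d M : ℕ) : Finset (List (Fin d)) :=
  (pairIndices d M).image fun a => pairWord a.2

/-- The coefficient of the word `w` in `∑ⱼ rⱼ L^j`: the sum of `r_j` over the pairs `(j, f)`,
`j ≤ M`, with doubled word `w` (there is exactly one, but this is not needed). [folklore] -/
def pairCoeff (d M : ℕ) (r : ℕ → ℝ) (w : List (Fin d)) : ℝ :=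
  ∑ a ∈ pairIndices d M with pairWord a.2 = w, r a.1

/-- **Resummation over doubled words**: for any `F`,
`∑_{w ∈ pairWords} pairCoeff w • F w = ∑_{j ≤ M} ∑_f r_j • F (pairWord f)`. [folklore] -/
theorem sum_pairCoeff_smul {V : Type*} [AddCommMonoid V] [Module ℝ V] (M : ℕ) (r : ℕ → ℝ)
    (F : List (Fin d) → V) :
    ∑ w ∈ pairWords d M, pairCoeff d M r w • F w =
      ∑ j ∈ Finset.range (M + 1), ∑ f : Fin j → Fin d, r j • F (pairWord f) := by
  unfold pairCoeff
  simp_rw [Finset.sum_smul]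
  rw [← Finset.sum_sigma (Finset.range (M + 1)) (fun _ => Finset.univ)
    (fun a : PairIndex d => r a.1 • F (pairWord a.2))]
  change _ = ∑ a ∈ pairIndices d M, r a.1 • F (pairWord a.2)
  rw [← Finset.sum_fiberwise_of_maps_to (s := pairIndices d M) (t := pairWords d M)
    (g := fun a => pairWord a.2) (fun a ha => Finset.mem_image_of_mem _ ha)]
  refine Finset.sum_congr rfl fun w _ => Finset.sum_congr rfl fun a ha => ?_
  rw [(Finset.mem_filter.1 ha).2]

/-- Every word of `pairWords d M` has length `≤ 2M`. [folklore] -/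
theorem length_le_of_mem_pairWords {M : ℕ} {w : List (Fin d)} (hw : w ∈ pairWords d M) :
    w.length ≤ 2 * M := by
  obtain ⟨a, ha, rfl⟩ := Finset.mem_image.1 hw
  rw [length_pairWord]
  have h := (Finset.mem_sigma.1 ha).1
  rw [Finset.mem_range] at h
  omega

end Words

section GroupSide

variable {A : Type*} [NormedCommRing A] [NormedAlgebra ℝ A] [NormedAlgebra ℚ A] [CompleteSpace A]
  [StarRing A] {N : Type*} [Fintype N] [DecidableEq N] {H : RealMatrixGroup A N}
  {G : Type*} [Group G] (ι : H.carrier →* G) {d : ℕ}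

variable [FiniteDimensional ℝ A]

/-- Iterated Lie derivatives of a finite sum of smooth functions. [folklore] -/
theorem iterLieDeriv_finset_sum {κ : Type*} (s : Finset κ) (w : List H.lie) {ψ : κ → G → ℂ}
    (hψ : ∀ k ∈ s, IsArchSmooth ι (ψ k)) :
    iterLieDeriv ι w (∑ k ∈ s, ψ k) = ∑ k ∈ s, iterLieDeriv ι w (ψ k) := by
  classical
  induction s using Finset.induction_on with
  | empty => rw [Finset.sum_empty, Finset.sum_empty, iterLieDeriv_zero]
  | insert k s hk ih =>
    rw [Finset.sum_insert hk, Finset.sum_insert hk,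
      iterLieDeriv_add_of_isArchSmooth_lieDeriv ι isArchSmooth_lieDeriv_holds (hψ k (by simp))
        ((archSmooth ι).sum_mem fun k' hk' =>
          hψ k' (Finset.mem_insert_of_mem hk')) w,
      ih fun k' hk' => hψ k' (Finset.mem_insert_of_mem hk')]

/-- **Expansion of the powers of a sum of squares**: for smooth `φ` and a family `b : Fin d → 𝔤`,
`(ψ ↦ ∑ᵢ bᵢ bᵢ ψ)^[j] φ = ∑_{f : Fin j → Fin d} (pairWord f).map b φ`. Nelson 1959, §8 (powers of
`Δ = ∑ Xᵢ²`). [folklore] -/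
theorem iterate_sqSum_eq_sum_pairWord (b : Fin d → H.lie) {φ : G → ℂ} (hφ : IsArchSmooth ι φ) :
    ∀ j : ℕ, (fun ψ => ∑ i, iterLieDeriv ι [b i, b i] ψ)^[j] φ =
      ∑ f : Fin j → Fin d, iterLieDeriv ι ((pairWord f).map b) φ
  | 0 => by simp
  | j + 1 => by
    rw [Function.iterate_succ_apply', iterate_sqSum_eq_sum_pairWord b hφ j]
    have hsm : ∀ f : Fin j → Fin d, IsArchSmooth ι (iterLieDeriv ι ((pairWord f).map b) φ) :=
      fun f => hφ.iterLieDeriv_of isArchSmooth_lieDeriv_holds _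
    calc (∑ i, iterLieDeriv ι [b i, b i] (∑ f : Fin j → Fin d, iterLieDeriv ι ((pairWord f).map b) φ))
        = ∑ i, ∑ f : Fin j → Fin d, iterLieDeriv ι ((pairWord (Fin.cons i f : Fin (j + 1) → Fin d)).map b) φ := by
          refine Finset.sum_congr rfl fun i _ => ?_
          rw [iterLieDeriv_finset_sum ι _ _ fun f _ => hsm f]
          refine Finset.sum_congr rfl fun f _ => ?_
          rw [pairWord_cons, List.map_cons, List.map_cons, ← iterLieDeriv_append]
          rfl
      _ = ∑ p : Fin d × (Fin j → Fin d),
            iterLieDeriv ι ((pairWord (Fin.cons p.1 p.2 : Fin (j + 1) → Fin d)).map b) φ := by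
          rw [← Finset.sum_product']
          rfl
      _ = ∑ f : Fin (j + 1) → Fin d, iterLieDeriv ι ((pairWord f).map b) φ :=
          Fintype.sum_equiv (Fin.consEquiv fun _ => Fin d) _ _ fun p => rfl

/-- **An annihilator `∑ⱼ rⱼ L_b^j φ = 0` as a word identity**: with `L_b ψ = ∑ᵢ bᵢ bᵢ ψ`,
`∑_{w ∈ pairWords} pairCoeff w · (w.map b) φ (x) = ∑_{j ≤ M} rⱼ (L_b^j φ)(x)` for smooth `φ`.
[folklore] -/
theorem sum_pairWords_iterLieDeriv_eq (b : Fin d → H.lie) {φ : G → ℂ} (hφ : IsArchSmooth ι φ)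
    (M : ℕ) (r : ℕ → ℝ) (x : G) :
    ∑ w ∈ pairWords d M, (pairCoeff d M r w : ℂ) * iterLieDeriv ι (w.map b) φ x =
      ∑ j ∈ Finset.range (M + 1),
        (r j : ℂ) * ((fun ψ => ∑ i, iterLieDeriv ι [b i, b i] ψ)^[j] φ) x := by
  have h := sum_pairCoeff_smul (V := ℂ) M r (fun w => iterLieDeriv ι (w.map b) φ x)
  simp only [Complex.real_smul] at h
  rw [h]
  refine Finset.sum_congr rfl fun j _ => ?_
  rw [iterate_sqSum_eq_sum_pairWord ι b hφ j, Finset.sum_apply, Finset.mul_sum]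

end GroupSide

/-! ### §2 The chart-side presentation and its ellipticity -/

section ChartSide

variable {d : ℕ}

/-- The matrix of the values of the fields at `x`: `fieldMatrix Ξ x i j = (Ξ i x) j`. [folklore] -/
def fieldMatrix (Ξ : Fin d → (Fin d → ℝ) → (Fin d → ℝ)) (x : Fin d → ℝ) : Matrix (Fin d) (Fin d) ℝ :=
  Matrix.of fun i j => Ξ i x j

/-- The field matrix is continuous in `x` for continuous fields. [folklore] -/
theorem continuous_fieldMatrix {Ξ : Fin d → (Fin d → ℝ) → (Fin d → ℝ)} (hΞ : ∀ i, Continuous (Ξ i)) :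
    Continuous (fieldMatrix Ξ) := by
  refine continuous_matrix fun i j => ?_
  exact (continuous_apply j).comp (hΞ i)

/-- At a point where `Ξ i 0 = eᵢ` the field matrix is the identity. [folklore] -/
theorem fieldMatrix_eq_one_of {Ξ : Fin d → (Fin d → ℝ) → (Fin d → ℝ)} {x : Fin d → ℝ}
    (h : ∀ i, Ξ i x = Pi.single i 1) : fieldMatrix Ξ x = 1 := by
  ext i j
  rw [fieldMatrix, Matrix.of_apply, h i, Matrix.one_apply, Pi.single_apply]
  simp only [eq_comm]

/-- **Where the field matrix is invertible, a covector killing all `Ξ i x` is zero.** [folklore] -/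
theorem eq_zero_of_forall_apply_field_eq_zero {Ξ : Fin d → (Fin d → ℝ) → (Fin d → ℝ)}
    {x : Fin d → ℝ} (hdet : (fieldMatrix Ξ x).det ≠ 0) {ξ : (Fin d → ℝ) →L[ℝ] ℝ}
    (hξ : ∀ i, ξ (Ξ i x) = 0) : ξ = 0 := by
  have hunit : IsUnit (fieldMatrix Ξ x).det := isUnit_iff_ne_zero.2 hdet
  ext v
  -- `v = ∑ᵢ αᵢ Ξ i x` with `α = v ᵥ* M⁻¹`
  set α : Fin d → ℝ := Matrix.vecMul v (fieldMatrix Ξ x)⁻¹ with hα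
  have hv : v = ∑ i, α i • Ξ i x := by
    have h1 : Matrix.vecMul α (fieldMatrix Ξ x) = v := by
      rw [hα, Matrix.vecMul_vecMul, Matrix.nonsing_inv_mul _ hunit, Matrix.vecMul_one]
    funext j
    rw [← h1, Finset.sum_apply]
    simp only [Matrix.vecMul, dotProduct, fieldMatrix, Matrix.of_apply, Pi.smul_apply,
      smul_eq_mul]
  rw [hv, map_sum]
  simp [hξ]

variable (Ξ : Fin d → (Fin d → ℝ) → (Fin d → ℝ)) (M : ℕ) (r : ℕ → ℝ)

/-- **The principal symbol of the pair presentation**: of order `2M` it is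
`r_M (∑ᵢ ξ(Ξ i x)²)^M`. [folklore] -/
theorem principalSymbol_pairPresentation (x : Fin d → ℝ) (ξ : (Fin d → ℝ) →L[ℝ] ℝ) :
    principalSymbol Ξ (pairWords d M) (fun w _ => pairCoeff d M r w) (2 * M) x ξ =
      r M * (∑ i, ξ (Ξ i x) ^ 2) ^ M := by
  unfold principalSymbol
  rw [Finset.sum_filter]
  have h := sum_pairCoeff_smul (V := ℝ) M r
    (fun w => if w.length = 2 * M then (w.map fun i => ξ (Ξ i x)).prod else 0)
  simp only [smul_eq_mul, mul_ite, mul_zero] at h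
  rw [h, Finset.sum_eq_single_of_mem M (Finset.mem_range.2 (Nat.lt_succ_self M))]
  · -- the term `j = M`
    simp only [length_pairWord, if_true]
    rw [← Finset.mul_sum, ← Fin.prod_const M (∑ i, ξ (Ξ i x) ^ 2), Finset.prod_univ_sum]
    simp only [Fintype.piFinset_univ]
    refine congrArg _ (Finset.sum_congr rfl fun f _ => ?_)
    rw [prod_map_pairWord]
    simp [sq]
  · -- the terms `j ≠ M` vanish
    intro j _ hj
    refine Finset.sum_eq_zero fun f _ => ?_
    rw [length_pairWord, if_neg]
    omega

/-- **Ellipticity of the pair presentation** where the fields span: if `r_M = 1` then on the set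
`{x | det (fieldMatrix Ξ x) ≠ 0}` the presentation `(Ξ, pairWords, pairCoeff)` is elliptic of
order `2M`. Folland 1995, Ch. 6 §C. [folklore] -/
theorem isEllipticOn_pairPresentation (hrM : r M = 1) {s : Set (Fin d → ℝ)}
    (hs : ∀ x ∈ s, (fieldMatrix Ξ x).det ≠ 0) :
    IsEllipticOn Ξ (pairWords d M) (fun w _ => pairCoeff d M r w) (2 * M) s := by
  refine ⟨fun w hw => length_le_of_mem_pairWords hw, fun x hx ξ hξ => ?_⟩
  rw [principalSymbol_pairPresentation, hrM, one_mul]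
  refine pow_ne_zero _ (ne_of_gt ?_)
  obtain ⟨i, hi⟩ : ∃ i, ξ (Ξ i x) ≠ 0 := by
    by_contra h
    push Not at h
    exact hξ (eq_zero_of_forall_apply_field_eq_zero (hs x hx) h)
  exact Finset.sum_pos' (fun i _ => sq_nonneg _) ⟨i, Finset.mem_univ _, by positivity⟩

end ChartSide

/-! ### §3 Moderate growth of Lie derivatives from the annihilator and elliptic regularity -/

section GroupLinear

variable {A : Type*} [NormedCommRing A] [NormedAlgebra ℝ A] [NormedAlgebra ℚ A] [CompleteSpace A]
  [StarRing A] {N : Type*} [Fintype N] [DecidableEq N] {H : RealMatrixGroup A N}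
  {G : Type*} [Group G] (ι : H.carrier →* G)

/-- The Lie derivative is linear in the direction on smooth functions (finite sums). [folklore] -/
theorem lieDeriv_finset_sum_smul_left [FiniteDimensional ℝ A] {κ : Type*} (s : Finset κ)
    (c : κ → ℝ) (Y : κ → H.lie) {φ : G → ℂ} (hφ : IsArchSmooth ι φ) :
    lieDeriv ι (∑ k ∈ s, c k • Y k) φ = ∑ k ∈ s, (c k : ℂ) • lieDeriv ι (Y k) φ := by
  classical
  induction s using Finset.induction_on with
  | empty => rw [Finset.sum_empty, Finset.sum_empty, lieDeriv_zero_left]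
  | insert k s hk ih =>
    rw [Finset.sum_insert hk, Finset.sum_insert hk, hφ.lieDeriv_add_left ι, ih,
      hφ.lieDeriv_smul_left ι, real_smul_fun_eq_coe_smul]

/-- An element of `𝔤` in the coordinates of a basis of the underlying submodule:
`X = ∑ᵢ (B.repr X)ᵢ • Bᵢ` in the Lie algebra. [folklore] -/
theorem eq_sum_repr_smul_basisLie {d : ℕ} (B : Module.Basis (Fin d) ℝ H.lie.toSubmodule)
    (X : H.lie) :
    X = ∑ i, (B.repr ⟨(X : Matrix N N A), X.2⟩ i) • basisLie B i := by
  apply Subtype.ext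
  have h := congrArg Subtype.val (B.sum_repr ⟨(X : Matrix N N A), X.2⟩)
  rw [AddSubmonoidClass.coe_finsetSum] at h
  refine h.symm.trans ?_
  rw [AddSubmonoidClass.coe_finsetSum]
  exact Finset.sum_congr rfl fun i _ => rfl

end GroupLinear

section Growth

variable {K : Type} [Field K] [NumberField K]
  {A : Type*} [NormedCommRing A] [NormedAlgebra ℝ A] [NormedAlgebra ℚ A] [CompleteSpace A]
  [StarRing A] {N : Type*} [Fintype N] [DecidableEq N]
  {𝒢 : AdelicGroupData K} {𝒟 : AutomorphyDatum 𝒢 A N}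

/-- Moderate growth is preserved by finite linear combinations. [folklore] -/
theorem hasModerateGrowth_finset_sum_smul {κ : Type*} (s : Finset κ) (c : κ → ℂ)
    {ψ : κ → 𝒢.Adelic → ℂ} (hψ : ∀ k ∈ s, HasModerateGrowth 𝒟 (ψ k)) :
    HasModerateGrowth 𝒟 (∑ k ∈ s, c k • ψ k) := by
  classical
  induction s using Finset.induction_on with
  | empty => rw [Finset.sum_empty]; exact hasModerateGrowth_zero 𝒟
  | insert k s hk ih =>
    rw [Finset.sum_insert hk]
    exact ((hψ k (by simp)).smul (c k)).add (ih fun k' hk' => hψ k' (Finset.mem_insert_of_mem hk'))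

/-- **Moderate growth of `Bᵢ φ` from an elliptic annihilator, granted Folland (8.45) and (6.34).**
Let `𝒟` be a regular automorphy datum over a finite-dimensional coefficient algebra, `B` a basis of
`𝔤` (indexed by `Fin d`), and `φ` an automorphic form with `∑_{j ≤ M} rⱼ L_B^j φ = 0` on `G(𝔸)`,
`L_B ψ = ∑ᵢ Bᵢ (Bᵢ ψ)`, `r_M = 1`. Then every `Bᵢ φ` has moderate growth, with the exponent of
`φ`. Proof: in the exponential chart of `B` the functions `t ↦ ℓ(φ(g ι(exp ∑ tᵢBᵢ)))` (`ℓ = Re, Im`,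
any `g`) solve `P v = 0` near `0`, `P = ∑_w c_w Ξ_w` the transported operator
(`smoothDiffOp_chartFun_eq_zero`), which is elliptic of order `2M` near `0`
(`isEllipticOn_pairPresentation`); the reproducing kernel `α` of `exists_kernel_of_isEllipticOn`
((8.45) + (6.34)) gives `φ(g) = ∫ α(t) φ(g ι(chartExp t)) dt` for all `g`, and
`exists_norm_lieDeriv_le_of_reproducing` turns it into `|(Bᵢφ)(g)| ≤ C sup_{supp α} |φ(g ι(chartExp t))|`,
bounded by the height axiom on the compact set `chartExp(supp α)`. This replaces Harish-Chandra's
`φ = φ ∗ α` (Harish-Chandra 1966, §8, Thm. 1; Borel 1972, 3.18) in Borel–Jacquet 1979, 4.3.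
[cite: BorelJacquetCorvallis1979, 4.3] -/
theorem HasModerateGrowth.lieDeriv_basisLie_of_folland [FiniteDimensional ℝ A]
    (h845 : Folland1995_thm845) (h634 : Folland1995_cor634) (h𝒟 : 𝒟.IsRegular)
    {d : ℕ} (B : Module.Basis (Fin d) ℝ 𝒟.arch.lie.toSubmodule) {φ : 𝒢.Adelic → ℂ}
    (hφ : IsAutomorphicForm 𝒟 φ) {M : ℕ} {r : ℕ → ℝ} (hrM : r M = 1)
    (hann : ∀ x, ∑ j ∈ Finset.range (M + 1),
      (r j : ℂ) * ((fun ψ => ∑ i, iterLieDeriv 𝒟.ofArch [basisLie B i, basisLie B i] ψ)^[j] φ) x = 0)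
    (i : Fin d) : HasModerateGrowth 𝒟 (lieDeriv 𝒟.ofArch (basisLie B i) φ) := by
  have hreg := h𝒟.mem_lie_of_expGL_mem
  haveI : Nonempty (Fin d) := ⟨i⟩
  have hφs : IsArchSmooth 𝒟.ofArch φ := hφ.archSmooth
  have hs : isArchSmooth_lieDeriv (ι := 𝒟.ofArch) := isArchSmooth_lieDeriv_holds
  -- chart fields and the word form of the annihilator
  obtain ⟨Ξ, Ω₀, hΞs, hΞ0, hΩ₀, h0Ω₀, hΞ⟩ := exists_chartFields (ι := 𝒟.ofArch) hreg B
  have hannw : ∀ x, ∑ w ∈ pairWords d M, (pairCoeff d M r w : ℂ) *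
      iterLieDeriv 𝒟.ofArch (w.map (basisLie B)) φ x = 0 := fun x => by
    rw [sum_pairWords_iterLieDeriv_eq 𝒟.ofArch (basisLie B) hφs M r x]
    exact hann x
  -- the radius of the reproducing bound in the direction `Bᵢ`
  obtain ⟨ρ₁, hρ₁, hF2⟩ :=
    exists_norm_lieDeriv_le_of_reproducing (ι := 𝒟.ofArch) hreg B (basisLie B i)
  -- the elliptic set and the domain
  set Ω₁ : Set (Fin d → ℝ) := {x | (fieldMatrix Ξ x).det ≠ 0} with hΩ₁_def
  have hΩ₁ : IsOpen Ω₁ :=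
    isOpen_ne.preimage ((continuous_fieldMatrix fun j => (hΞs j).continuous).matrix_det)
  have h0Ω₁ : (0 : Fin d → ℝ) ∈ Ω₁ := by
    change (fieldMatrix Ξ 0).det ≠ 0
    rw [fieldMatrix_eq_one_of hΞ0, Matrix.det_one]
    exact one_ne_zero
  let Ω : TopologicalSpace.Opens (Fin d → ℝ) :=
    ⟨(Ω₀ ∩ Ω₁) ∩ Metric.ball 0 ρ₁, (hΩ₀.inter hΩ₁).inter Metric.isOpen_ball⟩
  have h0Ω : (0 : Fin d → ℝ) ∈ (Ω : Set (Fin d → ℝ)) := ⟨⟨h0Ω₀, h0Ω₁⟩, Metric.mem_ball_self hρ₁⟩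
  have hell : IsEllipticOn Ξ (pairWords d M) (fun w _ => pairCoeff d M r w) (2 * M)
      (Ω : Set (Fin d → ℝ)) :=
    isEllipticOn_pairPresentation Ξ M r hrM fun x hx => hx.1.2
  -- the reproducing kernel (Folland (8.45) + (6.34))
  obtain ⟨U, h0U, hUΩ, α, hαs, hαc, hαU, hrep⟩ := exists_kernel_of_isEllipticOn h845 h634
    (volume : Measure (Fin d → ℝ)) hΞs (fun w _ => contDiff_const) hell h0Ω
  have hUΩ' : (U : Set (Fin d → ℝ)) ⊆ (Ω : Set (Fin d → ℝ)) := hUΩ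
  have hUΩ₀ : (U : Set (Fin d → ℝ)) ⊆ Ω₀ := fun x hx => (hUΩ' hx).1.1
  have hαρ : tsupport α ⊆ Metric.ball 0 ρ₁ := hαU.trans fun x hx => (hUΩ' hx).2
  -- the reproducing identity for every translate
  have hrepφ : ∀ g' : 𝒢.Adelic, φ g' = ∫ t, (α t : ℂ) * chartFun 𝒟.ofArch B φ g' t := by
    intro g'
    have hℓ : ∀ ℓ : ℂ →L[ℝ] ℝ, ℓ (φ g') = ∫ t, α t * ℓ (chartFun 𝒟.ofArch B φ g' t) := by
      intro ℓ
      have hv := hrep (fun t => ℓ (chartFun 𝒟.ofArch B φ g' t)) (contDiff_comp_chartFun B hφs ℓ g')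
        (fun x hx => smoothDiffOp_chartFun_eq_zero hΩ₀ hΞ hs hφs hannw ℓ g' x (hUΩ₀ hx))
      rwa [chartFun_apply, chartExp_zero, map_one, mul_one] at hv
    have hαc' : HasCompactSupport fun t => ((α t : ℝ) : ℂ) := hαc.comp_left Complex.ofReal_zero
    have hint : Integrable (fun t => (α t : ℂ) * chartFun 𝒟.ofArch B φ g' t) :=
      ((Complex.continuous_ofReal.comp hαs.continuous).mul
        (contDiff_chartFun B hφs g').continuous).integrable_of_hasCompactSupport hαc'.mul_right
    apply Complex.ext
    · rw [← Complex.reCLM_apply (φ g'), hℓ Complex.reCLM, ← RCLike.re_to_complex, ← integral_re hint]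
      refine integral_congr_ae (Filter.Eventually.of_forall fun t => ?_)
      simp
    · rw [← Complex.imCLM_apply (φ g'), hℓ Complex.imCLM, ← RCLike.im_to_complex, ← integral_im hint]
      refine integral_congr_ae (Filter.Eventually.of_forall fun t => ?_)
      simp
  -- constants
  obtain ⟨C, hC0, hC⟩ := hF2 α hαs hαc hαρ
  obtain ⟨D, hD⟩ := h𝒟.height_mul_ofArch_le ((chartExp B) '' tsupport α)
    (hαc.image (continuous_chartExp B))
  obtain ⟨C₀, n, hφg⟩ := hφ.moderateGrowth
  have hpos : ∀ g, (0 : ℝ) < 1 ⊔ 𝒟.height g := fun g => lt_of_lt_of_le one_pos le_sup_left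
  have hC₀ : 0 ≤ C₀ := by
    have := (norm_nonneg _).trans (hφg 1)
    exact nonneg_of_mul_nonneg_left this (pow_pos (hpos _) n)
  refine ⟨C * (C₀ * D ^ n), n, fun g => ?_⟩
  have hMg : ∀ t ∈ tsupport α, ‖chartFun 𝒟.ofArch B φ g t‖ ≤ C₀ * D ^ n * (1 ⊔ 𝒟.height g) ^ n := by
    intro t ht
    rw [chartFun_apply]
    calc ‖φ (g * 𝒟.ofArch (chartExp B t))‖
        ≤ C₀ * (1 ⊔ 𝒟.height (g * 𝒟.ofArch (chartExp B t))) ^ n := hφg _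
      _ ≤ C₀ * (D * (1 ⊔ 𝒟.height g)) ^ n :=
          mul_le_mul_of_nonneg_left
            (pow_le_pow_left₀ (hpos _).le (hD _ ⟨t, ht, rfl⟩ g) n) hC₀
      _ = C₀ * D ^ n * (1 ⊔ 𝒟.height g) ^ n := by rw [mul_pow, mul_assoc]
  have key := hC φ hφs g _ (fun s _ => hrepφ _) hMg
  calc ‖lieDeriv 𝒟.ofArch (basisLie B i) φ g‖ ≤ C * (C₀ * D ^ n * (1 ⊔ 𝒟.height g) ^ n) := key
    _ = C * (C₀ * D ^ n) * (1 ⊔ 𝒟.height g) ^ n := by ring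

/-- **Moderate growth of every `X φ`, `X ∈ 𝔤`**, under the same hypotheses (linearity of the Lie
derivative in `X` on smooth functions). Borel–Jacquet 1979, 4.3. [cite: BorelJacquetCorvallis1979, 4.3] -/
theorem HasModerateGrowth.lieDeriv_of_folland [FiniteDimensional ℝ A]
    (h845 : Folland1995_thm845) (h634 : Folland1995_cor634) (h𝒟 : 𝒟.IsRegular)
    {d : ℕ} (B : Module.Basis (Fin d) ℝ 𝒟.arch.lie.toSubmodule) {φ : 𝒢.Adelic → ℂ}
    (hφ : IsAutomorphicForm 𝒟 φ) {M : ℕ} {r : ℕ → ℝ} (hrM : r M = 1)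
    (hann : ∀ x, ∑ j ∈ Finset.range (M + 1),
      (r j : ℂ) * ((fun ψ => ∑ i, iterLieDeriv 𝒟.ofArch [basisLie B i, basisLie B i] ψ)^[j] φ) x = 0)
    (X : 𝒟.arch.lie) : HasModerateGrowth 𝒟 (lieDeriv 𝒟.ofArch X φ) := by
  rw [eq_sum_repr_smul_basisLie B X, lieDeriv_finset_sum_smul_left 𝒟.ofArch _ _ _ hφ.archSmooth]
  exact hasModerateGrowth_finset_sum_smul _ _ fun i _ =>
    HasModerateGrowth.lieDeriv_basisLie_of_folland h845 h634 h𝒟 B hφ hrM hann i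

/-! ### §4 Borel–Jacquet 4.3 from the annihilators and elliptic regularity -/

/-- **Borel–Jacquet 1979, 4.3 for a general regular datum, granted Folland (6.34), (8.45) and the
elliptic annihilators of its automorphic forms.** If every automorphic form `φ` of the regular
datum `𝒟` is annihilated by a real monic polynomial in a sum of squares `L_B = ∑ᵢ Bᵢ Bᵢ` over some
basis `B` of `𝔤` (supplied by `AutomorphicFormsEllipticAnnihilator`: Casimir element plus
`2 ∑_𝔨 Yᵢ²`, Borel 1972, 3.15–3.16), then — granted the elliptic regularity facts
`Folland1995_cor634` and `Folland1995_thm845` — the space of automorphic forms of `𝒟` is a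
`(𝔤, K_∞) × G(𝔸_f)`-stable subspace: the named fact `automorphicForms_isStableSubmodule 𝒟` of
`AutomorphicForms` (through `automorphicForms_isStableSubmodule_of_hasModerateGrowth_lieDeriv`).
[cite: BorelJacquetCorvallis1979, 4.3] -/
theorem automorphicForms_isStableSubmodule_of_folland_of_annihilators
    (h845 : Folland1995_thm845) (h634 : Folland1995_cor634)
    (hA : ∀ [FiniteDimensional ℝ A], 𝒟.IsRegular → ∀ φ : 𝒢.Adelic → ℂ, IsAutomorphicForm 𝒟 φ →
      ∃ (d : ℕ) (B : Module.Basis (Fin d) ℝ 𝒟.arch.lie.toSubmodule) (M : ℕ) (r : ℕ → ℝ),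
        r M = 1 ∧ ∀ x, ∑ j ∈ Finset.range (M + 1), (r j : ℂ) *
          ((fun ψ => ∑ i, iterLieDeriv 𝒟.ofArch [basisLie B i, basisLie B i] ψ)^[j] φ) x = 0) :
    automorphicForms_isStableSubmodule 𝒟 := by
  refine automorphicForms_isStableSubmodule_of_hasModerateGrowth_lieDeriv ?_
  intro _ h𝒟 φ hφ X
  obtain ⟨d, B, M, r, hrM, hann⟩ := hA h𝒟 φ hφ
  exact HasModerateGrowth.lieDeriv_of_folland h845 h634 h𝒟 B hφ hrM hann X

end Growth

end Literature.NumberTheory.Automorphic
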